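import Summits.QuantumFields.YangMills.Theorems.BalabanUVNodesN06AtRecord11ObligationsEH
import Literature.MathematicalPhysics.QuantumFieldTheory.Balaban1983to89.B9Ineq349Whole

/-!
# BalabanUVNodes ∕ N06 ([B9], `Dag.B9_main`) — OBLIGATIONS OF THE STAGE-11 CERTIFICATE KNIT AT THE RECORD, VIII:
# the (3.49) leaf `s349` SUPPLIED BY NAME from seat n06-i's `B9Ineq349Whole` (row 25): Theorem 3.1 + Theorem 3.2 (both DERIVED inside the chain) + the (3.25) dictionary

Track A of `YM-PLAN.md` (cell `pub-ymgap`, HUMAN RULING D-0062), node **N06** = [Balaban1985BackgroundPropagators] Thms 3.1–3.15; seat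
`pub-ymgap-dag-n06-d` gen 2 = dag-lead N06-ASSIGNMENT v1 (P3) «THE KNIT AT THE RECORD».  Sequel of `BalabanUVNodesN06AtRecord11ObligationsEH`.

THE POINT.  The certificate's binder `s349 : B9.Stmt349Printed (θ.d₆+1) c35Y geo9Y (bg9Y …) (fun x => (ops x).P349)` ((3.49) p. 399: the four kernel bounds of
P = I − R = G′Q′*(Q′G′²Q′*)⁻¹Q′G′, by (3.25) p. 394) is, by seat n06-i's `B9Ineq349Whole.stmt349Printed_of_thm31_thm32` (p461761), a consequence of Theorem 3.1 as typed
for `Gp`, Theorem 3.2 as typed for `Cinv`, the sign schema `ModelSignsOn`, the distance facts `DistOK` per member, ONE `L` for the family, Lemma 2.1 of [4] as the family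
schemas `LevelGap geo R` ((2.60), geometric) and `RowSum261 geo` ((2.61), generic constant under an M-threshold), and the (3.25)-in-kernels dictionary `Dict349` per member.
IN THE CHAIN OF RECORD Theorem 3.1 and Theorem 3.2 are DERIVED, not displayed: `B9.thm31_of_thm37` from `t37` (supplied at the walk pin, sequel II) and `hsum` (its (3.42)
half supplied, sequel I §2, the rest displayed), `B9.thm32_of_thm39` from the binders `t39`, `hksum`.  So at the record row 25 COSTS: `hdict` (an operator-layer reading,
def-Y's instance owes it with `P349`'s reading) + the record-geometry facts `DistOK (geo9Y x)`, `LevelGap geo9Y R`, `RowSum261 geo9Y` — DISPLAYED here (they are facts of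
the record's k-level tori: symmetric ∕ triangle contour distance (2.46), (2.60) with the members' `(R − 1)·M`, (2.61) pulled back along the carrier-block map with the
fibre factor `2(d+1)` — `B6Geom246MultiLevelTorus`, `B6Lemma21ParamKLevelTorus`, `Node00.CarriersB6KDischarge.lemma21Param_tower`; their discharge at `geo9Y` is the
next link), with `S := modelSignsOn_geo9K` and `hLi : (geo9Y x).L = L` (`rfl`, `L = ℓ + 1 ≥ 2`) DISCHARGED.

WHAT THIS MODULE DOES (kernel bookkeeping; 0 `def`, 0 `sorry`, standard axioms; COUNT-NEUTRAL, `--supports` K1 `StabilityBAtRecordR11e`):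
* `b9_main_of_up_view₁₁B10YZW_of_obligations_W38T314SectBnHgEHS349supplied` — the chain of record with `s349` REPLACED by `hdict` + `DistOK` ∕ `LevelGap` ∕ `RowSum261`:
  19 operator-layer obligations + `hdict` + walk pin ∕ schemas ∕ readings ∕ co-readings ∕ residual + (β)(γ) + 24 Sect.-B steps + 3 record-geometry facts, displayed.

HONEST FRAMING.  Nothing of [B9] is proved for Bałaban's operators; no `OpsY` ∕ `Ops` instance over the record's lattice operators exists in the tree; k stays 0 ∕ 28 in the
referee's sense; N06 is NOT discharged.  One finite four-torus programme at fixed `ε` — NOT ℝ⁴, NOT OS, NOT a mass gap, NOT Clay.  No `def`.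
-/

noncomputable section

namespace Summit.QuantumFields.YangMills.BalabanUVNodes.N06AtRecord11ObligationsS349

open Literature.MathematicalPhysics.QuantumFieldTheory.Balaban1983to89
open Literature.MathematicalPhysics.QuantumFieldTheory.Balaban1983to89.T4Continuum (T4Family FiniteEpsData)
open Literature.MathematicalPhysics.QuantumFieldTheory.Balaban1983to89.DagBinding (WorldP leavesP B9LeafX)
open Literature.MathematicalPhysics.QuantumFieldTheory.Balaban1983to89.Node00
open Literature.MathematicalPhysics.QuantumFieldTheory.Balaban1983to89.B9PinMembersKLevelV1 (MemberY geo9Y bg9Y)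
open Literature.MathematicalPhysics.QuantumFieldTheory.Balaban1983to89.B9PinGeometryKLevelV1 (dOmegaY OmKY inΛY unitDistY InCubeY c35Y)
open Literature.MathematicalPhysics.QuantumFieldTheory.Balaban1983to89.B7Prop2SpecialUnitary (specialUnitaryUnits)
open Literature.MathematicalPhysics.QuantumFieldTheory.Balaban1983to89.B9Thm37Whole (Ops Conv342 Sizes StaticOK Local342 Identities const37)
open Literature.MathematicalPhysics.QuantumFieldTheory.Balaban1983to89.B9Cor38Whole (WalkReading Locality W38OfOps)
open Literature.MathematicalPhysics.QuantumFieldTheory.Balaban1983to89.B9Thm37GlueCor36 (CoRealizes)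
open Literature.MathematicalPhysics.QuantumFieldTheory.Balaban1983to89.B6RandomWalk (Ineq261)
open Literature.MathematicalPhysics.QuantumFieldTheory.Balaban1983to89.B9Thm34Ext (toB6)
open Literature.MathematicalPhysics.QuantumFieldTheory.Balaban1983to89.B9Thm314 (Thm314LocalPrinted IneqSupF)
open Literature.MathematicalPhysics.QuantumFieldTheory.Balaban1983to89.B9SectBStepWhole
  (StepE StepL2n StepGlob StepH1 StepE4 StepH2 StepKer StepAnalytic)
open Literature.MathematicalPhysics.QuantumFieldTheory.Balaban1983to89.B9Ineq349Whole (Dict349 DistOK LevelGap RowSum261 stmt349Printed_of_thm31_thm32)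
open Literature.MathematicalPhysics.QuantumFieldTheory.Balaban1983to89.B9GeoNormsKLevelModelSignsV1 (modelSignsOn_geo9K)
open Summit.QuantumFields.YangMills.BalabanUVNodes.N06AtRecord11Obligations (const37_nonneg rwSumsYieldIneqs_of_conv342_pin)
open Summit.QuantumFields.YangMills.BalabanUVNodes.N06AtRecord11ObligationsW38 (thm37_obligation_of_local342_W38OfOps)
open Summit.QuantumFields.YangMills.BalabanUVNodes.N06AtRecord11ObligationsEH (b9_main_of_up_view₁₁B10YZW_of_obligations_W38T314SectBnHgEHsupplied)
open scoped Matrix.Norms.L2Operator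

variable {N : ℕ}

/-! ## THE KNIT AT ₁₁ — the chain of record with `s349` supplied -/

section Pointed

variable [NeZero N] {F : T4Family}

/-- **THE CHAIN OF RECORD WITH `s349` SUPPLIED** (row 25, seat n06-i's `stmt349Printed_of_thm31_thm32`): Theorem 3.1 ∕ 3.2 as typed are DERIVED inside —
`B9.thm31_of_thm37` from the walk-pinned `t37` (`thm37_obligation_of_local342_W38OfOps`) and the co-read `hsum` (`rwSumsYieldIneqs_of_conv342_pin`), `B9.thm32_of_thm39` from
`t39`, `hksum` — the sign schema is `modelSignsOn_geo9K`, `L := θ.ℓ₆ + 1` by `rfl`; DISPLAYED in place of `s349`: `hdict` ((3.25) in kernels, an operator-layer reading) and the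
record-geometry facts `DistOK`, `LevelGap`, `RowSum261` of the member tori.  `Dag.B9_main` at every run of a world bound over the four-pin Stage-11 view FROM 19 operator-layer
obligations (`hGp_e hGp_h1 hC hGA_e hGA_h1 hGA_e4 hGA_h2 hGA_l2 hGp hGA t39 t310 hksum t311 t312 t313 t315 s3132 t314loc`) + `hdict` + the rest of the chain's displayed schemas.
Displayed and nothing else; NOT a discharge of N06. [cite: Balaban1985BackgroundPropagators, (3.49) p.399, (3.25) p.394, Thm 3.1 (3.42) p.397, Thm 3.2 (3.48) p.398; Balaban1984PropagatorsII, Lemma 2.1 (2.59)–(2.61) pp.233–234] -/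
theorem b9_main_of_up_view₁₁B10YZW_of_obligations_W38T314SectBnHgEHS349supplied (θ : Stage11Params F N) (hθ : θ.Admissible) (Mstar : ℕ)
    (ops : OpsY N θ.toStage3Params Mstar) (ζ : ResidZ F N) (lamW : ResidW F N) (w : WorldP)
    (hup : ∀ P, w.up P = upOfRecord₅C F N (θ.view₁₁B10YZW F N Mstar ops ζ lamW) P)
    (hGp_e : ∀ (x : MemberY θ.d₆ θ.ℓ₆ θ.hd' θ.hL' θ.b₀ θ.b₁ Mstar) (n : Fin 4) (lam : (geo9Y x).Loc) (y : (geo9Y x).Site),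
      (ops x).Gp.e n (bg9Y (Matrix (Fin N) (Fin N) ℂ) (specialUnitaryUnits (Fin N)) x).one lam y ≤ (Node00.GpU x.toKIdx).e n lam y)
    (hGp_h1 : ∀ (x : MemberY θ.d₆ θ.ℓ₆ θ.hd' θ.hL' θ.b₀ θ.b₁ Mstar) (lam : (geo9Y x).Loc) (b : ℝ) (c : (geo9Y x).Cut),
      (ops x).Gp.h1 (bg9Y (Matrix (Fin N) (Fin N) ℂ) (specialUnitaryUnits (Fin N)) x).one lam b c ≤ (Node00.GpU x.toKIdx).h1 lam b c)
    (hC : ∀ (x : MemberY θ.d₆ θ.ℓ₆ θ.hd' θ.hL' θ.b₀ θ.b₁ Mstar) (y y' : (geo9Y x).Site),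
      |(ops x).Cinv.ker (bg9Y (Matrix (Fin N) (Fin N) ℂ) (specialUnitaryUnits (Fin N)) x).one y y'| ≤ |(Node00.CinvU x.toKIdx).ker y y'|)
    (hGA_e : ∀ (x : MemberY θ.d₆ θ.ℓ₆ θ.hd' θ.hL' θ.b₀ θ.b₁ Mstar) (n : Fin 4) (lam : (geo9Y x).Loc) (y : (geo9Y x).Site),
      (ops x).GA.e n (bg9Y (Matrix (Fin N) (Fin N) ℂ) (specialUnitaryUnits (Fin N)) x).one lam y ≤ (Node00.GU x.toKIdx).e n lam y)
    (hGA_h1 : ∀ (x : MemberY θ.d₆ θ.ℓ₆ θ.hd' θ.hL' θ.b₀ θ.b₁ Mstar) (lam : (geo9Y x).Loc) (b : ℝ) (c : (geo9Y x).Cut),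
      (ops x).GA.h1 (bg9Y (Matrix (Fin N) (Fin N) ℂ) (specialUnitaryUnits (Fin N)) x).one lam b c ≤ (Node00.GU x.toKIdx).h1 lam b c)
    (hGA_e4 : ∀ (x : MemberY θ.d₆ θ.ℓ₆ θ.hd' θ.hL' θ.b₀ θ.b₁ Mstar) (lam : (geo9Y x).Loc) (y : (geo9Y x).Site),
      (ops x).GA.e4 (bg9Y (Matrix (Fin N) (Fin N) ℂ) (specialUnitaryUnits (Fin N)) x).one lam y ≤ (Node00.GU x.toKIdx).e4 lam y)
    (hGA_h2 : ∀ (x : MemberY θ.d₆ θ.ℓ₆ θ.hd' θ.hL' θ.b₀ θ.b₁ Mstar) (lam : (geo9Y x).Loc) (b : ℝ) (c : (geo9Y x).Cut),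
      (ops x).GA.h2 (bg9Y (Matrix (Fin N) (Fin N) ℂ) (specialUnitaryUnits (Fin N)) x).one lam b c ≤ (Node00.GU x.toKIdx).h2 lam b c)
    (hGA_l2 : ∀ (x : MemberY θ.d₆ θ.ℓ₆ θ.hd' θ.hL' θ.b₀ θ.b₁ Mstar) (n : Fin 6) (lam : (geo9Y x).Loc) (hc : (geo9Y x).Cut),
      (ops x).GA.l2 n (bg9Y (Matrix (Fin N) (Fin N) ℂ) (specialUnitaryUnits (Fin N)) x).one lam hc ≤ (Node00.GU x.toKIdx).l2 n lam hc)
    (hGp : B9FromB6.ResidualGpAtOne geo9Y (bg9Y (Matrix (Fin N) (Fin N) ℂ) (specialUnitaryUnits (Fin N))) (fun x => (ops x).Gp))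
    (hGA : B9FromB6.ResidualGAGlobAtOne geo9Y (bg9Y (Matrix (Fin N) (Fin N) ℂ) (specialUnitaryUnits (Fin N))) (fun x => (ops x).GA))
    -- in place of `hB`: n06-c's fourteen printed block-steps of Sect. B (§1)
    (hA : StepAnalytic (θ.d₆ + 1) c35Y geo9Y (bg9Y (Matrix (Fin N) (Fin N) ℂ) (specialUnitaryUnits (Fin N))) (fun x => (ops x).Gp) (fun x => (ops x).GA)
      (fun x => (ops x).Cinv) (fun x => (ops x).IsAnalyticExt))
    (hEp : StepE (θ.d₆ + 1) c35Y geo9Y (bg9Y (Matrix (Fin N) (Fin N) ℂ) (specialUnitaryUnits (Fin N))) (fun x => (ops x).Gp) (fun x => (ops x).GA)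
      (fun x => (ops x).Cinv) (fun x => (ops x).Gp))
    (hLp : ∀ n : Fin 6, StepL2n (θ.d₆ + 1) c35Y geo9Y (bg9Y (Matrix (Fin N) (Fin N) ℂ) (specialUnitaryUnits (Fin N))) (fun x => (ops x).Gp) (fun x => (ops x).GA)
      (fun x => (ops x).Cinv) (fun x => (ops x).Gp) n)
    (hGlp : StepGlob (θ.d₆ + 1) c35Y geo9Y (bg9Y (Matrix (Fin N) (Fin N) ℂ) (specialUnitaryUnits (Fin N))) (fun x => (ops x).Gp) (fun x => (ops x).GA)
      (fun x => (ops x).Cinv) (fun x => (ops x).Gp))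
    (hH1p : StepH1 (θ.d₆ + 1) c35Y geo9Y (bg9Y (Matrix (Fin N) (Fin N) ℂ) (specialUnitaryUnits (Fin N))) (fun x => (ops x).Gp) (fun x => (ops x).GA)
      (fun x => (ops x).Cinv) (fun x => (ops x).Gp))
    (hE4p : StepE4 (θ.d₆ + 1) c35Y geo9Y (bg9Y (Matrix (Fin N) (Fin N) ℂ) (specialUnitaryUnits (Fin N))) (fun x => (ops x).Gp) (fun x => (ops x).GA)
      (fun x => (ops x).Cinv) (fun x => (ops x).Gp))
    (hH2p : StepH2 (θ.d₆ + 1) c35Y geo9Y (bg9Y (Matrix (Fin N) (Fin N) ℂ) (specialUnitaryUnits (Fin N))) (fun x => (ops x).Gp) (fun x => (ops x).GA)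
      (fun x => (ops x).Cinv) (fun x => (ops x).Gp))
    (hK : StepKer (θ.d₆ + 1) c35Y geo9Y (bg9Y (Matrix (Fin N) (Fin N) ℂ) (specialUnitaryUnits (Fin N))) (fun x => (ops x).Gp) (fun x => (ops x).GA)
      (fun x => (ops x).Cinv) (fun x => (ops x).Cinv))
    (hEa : StepE (θ.d₆ + 1) c35Y geo9Y (bg9Y (Matrix (Fin N) (Fin N) ℂ) (specialUnitaryUnits (Fin N))) (fun x => (ops x).Gp) (fun x => (ops x).GA)
      (fun x => (ops x).Cinv) (fun x => (ops x).GA))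
    (hLa : ∀ n : Fin 6, StepL2n (θ.d₆ + 1) c35Y geo9Y (bg9Y (Matrix (Fin N) (Fin N) ℂ) (specialUnitaryUnits (Fin N))) (fun x => (ops x).Gp) (fun x => (ops x).GA)
      (fun x => (ops x).Cinv) (fun x => (ops x).GA) n)
    (hGla : StepGlob (θ.d₆ + 1) c35Y geo9Y (bg9Y (Matrix (Fin N) (Fin N) ℂ) (specialUnitaryUnits (Fin N))) (fun x => (ops x).Gp) (fun x => (ops x).GA)
      (fun x => (ops x).Cinv) (fun x => (ops x).GA))
    (hH1a : StepH1 (θ.d₆ + 1) c35Y geo9Y (bg9Y (Matrix (Fin N) (Fin N) ℂ) (specialUnitaryUnits (Fin N))) (fun x => (ops x).Gp) (fun x => (ops x).GA)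
      (fun x => (ops x).Cinv) (fun x => (ops x).GA))
    (hE4a : StepE4 (θ.d₆ + 1) c35Y geo9Y (bg9Y (Matrix (Fin N) (Fin N) ℂ) (specialUnitaryUnits (Fin N))) (fun x => (ops x).Gp) (fun x => (ops x).GA)
      (fun x => (ops x).Cinv) (fun x => (ops x).GA))
    (hH2a : StepH2 (θ.d₆ + 1) c35Y geo9Y (bg9Y (Matrix (Fin N) (Fin N) ℂ) (specialUnitaryUnits (Fin N))) (fun x => (ops x).Gp) (fun x => (ops x).GA)
      (fun x => (ops x).Cinv) (fun x => (ops x).GA))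
    -- in place of `t37`, `c38`, `hsum`: as in sequel II
    [∀ x : MemberY θ.d₆ θ.ℓ₆ θ.hd' θ.hL' θ.b₀ θ.b₁ Mstar, Fintype (geo9Y x).Site]
    [∀ x : MemberY θ.d₆ θ.ℓ₆ θ.hd' θ.hL' θ.b₀ θ.b₁ Mstar, DecidableEq (geo9Y x).Site]
    {X Y ι : MemberY θ.d₆ θ.ℓ₆ θ.hd' θ.hL' θ.b₀ θ.b₁ Mstar → Type}
    [∀ x, Fintype (X x)] [∀ x, DecidableEq (X x)] [∀ x, Fintype (Y x)] [∀ x, DecidableEq (Y x)] [∀ x, Fintype (ι x)]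
    (𝔬 : ∀ x, Ops (geo9Y x) (bg9Y (Matrix (Fin N) (Fin N) ℂ) (specialUnitaryUnits (Fin N)) x) (X x) (Y x) (ι x))
    (rd : ∀ x, WalkReading (geo9Y x) (bg9Y (Matrix (Fin N) (Fin N) ℂ) (specialUnitaryUnits (Fin N)) x) (X x) (ι x))
    (R : MemberY θ.d₆ θ.ℓ₆ θ.hd' θ.hL' θ.b₀ θ.b₁ Mstar → ℝ) (H : MemberY θ.d₆ θ.ℓ₆ θ.hd' θ.hL' θ.b₀ θ.b₁ Mstar → Prop)
    (κ : MemberY θ.d₆ θ.ℓ₆ θ.hd' θ.hL' θ.b₀ θ.b₁ Mstar → Sizes) (d : ℕ) (α ρ Nc N' Cℓ K θ₀ B₀ δ₀ a₁ M₁ ML : ℝ)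
    (hα : 0 ≤ α) (hα2 : α ≤ 1 / 2) (hN : 0 ≤ Nc) (hN' : 0 ≤ N') (hCℓ : 1 ≤ Cℓ) (hK0 : 0 ≤ K) (hθ₀ : 0 ≤ θ₀) (hB₀ : 0 < B₀) (hδ₀ : 0 < δ₀)
    (ha₁ : 0 < a₁) (hM₁ : 0 < M₁)
    (hst : ∀ x, StaticOK (𝔬 x) ρ Nc N' Cℓ (κ x)) (hκ : ∀ x, (κ x).Bounded K θ₀ Cℓ (geo9Y x).M)
    (hrd : ∀ x, (rd x).OK (𝔬 x).blk) (hloc : ∀ x, Locality (𝔬 x) (rd x))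
    (h261 : ∀ x, ML ≤ (geo9Y x).M → Ineq261 d (toB6 (geo9Y x) (R x) (H x)) δ₀ α)
    (h36 : ∀ x, M₁ ≤ (geo9Y x).M → ∀ α₀ : ℝ, 0 < α₀ → c35Y * (geo9Y x).M * α₀ ≤ a₁ →
      ∀ U : (bg9Y (Matrix (Fin N) (Fin N) ℂ) (specialUnitaryUnits (Fin N)) x).Cfg,
        (bg9Y (Matrix (Fin N) (Fin N) ℂ) (specialUnitaryUnits (Fin N)) x).Reg335 c35Y α₀ U →
          Local342 (𝔬 x) (R x) (H x) B₀ δ₀ U ∧ Identities (𝔬 x) (R x) (H x) U)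
    (hE38 : ∀ x, (ops x).E37 = W38OfOps (𝔬 x) (rd x) (R x) (H x) (const37 d δ₀ α ρ B₀ Nc N' Cℓ K) ((1 - 2 * α) * δ₀))
    (evY : ∀ x : MemberY θ.d₆ θ.ℓ₆ θ.hd' θ.hL' θ.b₀ θ.b₁ Mstar, (geo9Y x).Loc → Y x → ℝ)
    (hco0 : ∀ x U, CoRealizes (ops x).Gp 0 U (𝔬 x).blk (𝔬 x).blk (rd x).ev ((𝔬 x).Gp U))
    (hco1 : ∀ x U, CoRealizes (ops x).Gp 1 U (𝔬 x).blkY (𝔬 x).blk (rd x).ev ((𝔬 x).D U ∘ₗ (𝔬 x).Gp U))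
    (hco2 : ∀ x U, CoRealizes (ops x).Gp 2 U (𝔬 x).blk (𝔬 x).blkY (evY x) ((𝔬 x).Gp U ∘ₗ (𝔬 x).Dstar U))
    (hco3 : ∀ x U, CoRealizes (ops x).Gp 3 U (𝔬 x).blk (𝔬 x).blk (rd x).ev ((𝔬 x).Lap U ∘ₗ (𝔬 x).Gp U))
    {B₁ δ₁ : ℝ} (hB₁ : 0 < B₁) (hδ₁ : 0 < δ₁) (hCB : const37 d δ₀ α ρ B₀ Nc N' Cℓ K ≤ B₁) (hδ₁le : δ₁ ≤ (1 - 2 * α) * δ₀)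
    {Bβ Bε : ℝ → ℝ} {Bεβ : ℝ → ℝ → ℝ}
    (hrest : ∀ (x : MemberY θ.d₆ θ.ℓ₆ θ.hd' θ.hL' θ.b₀ θ.b₁ Mstar) (U : (bg9Y (Matrix (Fin N) (Fin N) ℂ) (specialUnitaryUnits (Fin N)) x).Cfg),
      ((ops x).E37).Converges U →
        (∀ (n : Fin 6) (lam : (geo9Y x).Loc) (h : (geo9Y x).Cut) (y y' : (geo9Y x).Site), (geo9Y x).cutIn h y → (geo9Y x).suppIn lam y' →
            (ops x).Gp.l2 n U lam h ≤ B₁ * B9.pref6 ((geo9Y x).len y) n * (geo9Y x).cutSup h * Real.exp (-(δ₁ * (geo9Y x).dist y y')) * (geo9Y x).l2Norm lam) ∧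
        (∀ (n : Fin 4) (lam : (geo9Y x).Loc) (γ : ℝ), -4 ≤ γ → γ ≤ 4 → (ops x).Gp.glob n U lam γ ≤ B₁ * (geo9Y x).wNorm γ lam) ∧
        B9.Ineq343_345 (ops x).Gp Bβ Bε Bεβ δ₁ U)
    (h310 : ∀ (x : MemberY θ.d₆ θ.ℓ₆ θ.hd' θ.hL' θ.b₀ θ.b₁ Mstar) (U : (bg9Y (Matrix (Fin N) (Fin N) ℂ) (specialUnitaryUnits (Fin N)) x).Cfg),
      ((ops x).E310).Converges U → B9.Ineq342_346_347 (ops x).GA B₁ δ₁ U ∧ B9.Ineq343_345 (ops x).GA Bβ Bε Bεβ δ₁ U)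
    -- in place of `t314`: (γ) and (β) of sequel III
    (r : ℝ)
    (hgeo : ∀ (x : MemberY θ.d₆ θ.ℓ₆ θ.hd' θ.hL' θ.b₀ θ.b₁ Mstar) (y y' : (geo9Y x).Site), ¬ (OmKY x y ∧ OmKY x y') →
      dOmegaY x y y' ≤ (geo9Y x).dist y y' + r)
    (hplain : ∃ M₁ δ₁ a₁ B₁ : ℝ, 0 < M₁ ∧ 0 < δ₁ ∧ 0 < a₁ ∧ 0 < B₁ ∧
      ∀ x : MemberY θ.d₆ θ.ℓ₆ θ.hd' θ.hL' θ.b₀ θ.b₁ Mstar, M₁ ≤ (geo9Y x).M → ∀ α₀ : ℝ, 0 < α₀ → (geo9Y x).M * α₀ ≤ a₁ →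
        ∀ U : (bg9Y (Matrix (Fin N) (Fin N) ℂ) (specialUnitaryUnits (Fin N)) x).Cfg,
          (bg9Y (Matrix (Fin N) (Fin N) ℂ) (specialUnitaryUnits (Fin N)) x).Reg335 c35Y α₀ U → IneqSupF (ops x).Kdiff B₁ δ₁ (fun _ => True) (fun _ _ => 1) U)
    -- the remaining printed leaves, verbatim
    (t39 : B9.Thm39Printed (θ.d₆ + 1) c35Y geo9Y (bg9Y (Matrix (Fin N) (Fin N) ℂ) (specialUnitaryUnits (Fin N))) (fun x => (ops x).EK39))
    (t310 : B9.Thm310Printed c35Y geo9Y (bg9Y (Matrix (Fin N) (Fin N) ℂ) (specialUnitaryUnits (Fin N))) (fun x => (ops x).E310))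
    (hksum : B9.RWKernelSumYields (θ.d₆ + 1) geo9Y (bg9Y (Matrix (Fin N) (Fin N) ℂ) (specialUnitaryUnits (Fin N))) (fun x => (ops x).EK39)
      (fun x => (ops x).Cinv))
    (t311 : B9.Thm311Printed c35Y geo9Y (bg9Y (Matrix (Fin N) (Fin N) ℂ) (specialUnitaryUnits (Fin N))) (fun x => (ops x).PosDef))
    (t312 : B9.Thm312Printed (θ.d₆ + 1) c35Y geo9Y (bg9Y (Matrix (Fin N) (Fin N) ℂ) (specialUnitaryUnits (Fin N))) (fun x => (ops x).GD)
      (fun x => (ops x).G₁) (fun x => (ops x).H) (fun x => (ops x).H₁) (fun x => (ops x).HasRWExp) (fun x => (ops x).HasRWExpH)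
      (fun x => (ops x).PosDefK))
    (t313 : B9.Thm313Printed c35Y geo9Y (bg9Y (Matrix (Fin N) (Fin N) ℂ) (specialUnitaryUnits (Fin N))) (fun x => (ops x).GG)
      (fun x => (ops x).HasRWExp) (fun x => (ops x).PosDefK))
    (t315 : B9.Thm315FullPrinted c35Y geo9Y (bg9Y (Matrix (Fin N) (Fin N) ℂ) (specialUnitaryUnits (Fin N))) (fun x => (ops x).Ck) inΛY unitDistY
      (fun x => (ops x).GivenBy3185) (fun x => (ops x).HasRWExpC))
    -- in place of `s349`: n06-i's (3.25) dictionary + the three record-geometry facts (row 25)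
    (hdict : ∀ x : MemberY θ.d₆ θ.ℓ₆ θ.hd' θ.hL' θ.b₀ θ.b₁ Mstar, Dict349 (ops x).Gp (ops x).Cinv (ops x).P349)
    (D349 : ∀ x : MemberY θ.d₆ θ.ℓ₆ θ.hd' θ.hL' θ.b₀ θ.b₁ Mstar, DistOK (geo9Y x))
    {R₀ : ℝ} (hR₀ : 0 < R₀) (hgap : LevelGap (geo9Y (d := θ.d₆) (ℓ := θ.ℓ₆) (hd := θ.hd') (hL := θ.hL') (b₀ := θ.b₀) (b₁ := θ.b₁) (Mstar := Mstar)) R₀)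
    (h261row : RowSum261 (geo9Y (d := θ.d₆) (ℓ := θ.ℓ₆) (hd := θ.hd') (hL := θ.hL') (b₀ := θ.b₀) (b₁ := θ.b₁) (Mstar := Mstar)))
    (s3132 : B9.Stmt3132Printed (θ.d₆ + 1) c35Y geo9Y (bg9Y (Matrix (Fin N) (Fin N) ℂ) (specialUnitaryUnits (Fin N))) (fun x => (ops x).QGQinv)
      (fun x => (ops x).QG1Qinv))
    (t314loc : Thm314LocalPrinted c35Y geo9Y (bg9Y (Matrix (Fin N) (Fin N) ℂ) (specialUnitaryUnits (Fin N))) (fun x => (ops x).Kdiff) OmKY dOmegaY)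
    (P : B12.RunParams) : Dag.B9_main (leavesP w P) := by
  -- Theorem 3.1 ∕ 3.2 as typed, DERIVED from the chain's own supplied∕displayed leaves
  have h37 := thm37_obligation_of_local342_W38OfOps θ.toStage3Params Mstar ops 𝔬 rd R H κ d α ρ Nc N' Cℓ K θ₀ B₀ δ₀ a₁ M₁ ML hα hα2 hN hN' hCℓ hK0 hB₀.le
    hδ₀.le ha₁ hM₁ hst hκ h261 h36 hE38
  have hsum := rwSumsYieldIneqs_of_conv342_pin θ.toStage3Params Mstar ops 𝔬 R H (const37_nonneg d hB₀.le hN hN' hCℓ hK0) (fun x => (rd x).ev) evY hco0 hco1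
    hco2 hco3 (fun x U h => by rw [hE38 x] at h; exact h) hB₁ hδ₁ hCB hδ₁le hrest h310
  have h31 := B9.thm31_of_thm37 c35Y geo9Y (bg9Y (Matrix (Fin N) (Fin N) ℂ) (specialUnitaryUnits (Fin N))) (fun x => (ops x).E37) (fun x => (ops x).E310)
    (fun x => (ops x).Gp) (fun x => (ops x).GA) h37 hsum
  have h32 := B9.thm32_of_thm39 (θ.d₆ + 1) c35Y geo9Y (bg9Y (Matrix (Fin N) (Fin N) ℂ) (specialUnitaryUnits (Fin N))) (fun x => (ops x).EK39) (fun x => (ops x).Cinv) t39 hksum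
  have hL1 : (1 : ℝ) ≤ ((θ.ℓ₆ + 1 : ℕ) : ℝ) := by exact_mod_cast Nat.succ_le_succ (Nat.zero_le _)
  have s349 : B9.Stmt349Printed (θ.d₆ + 1) c35Y geo9Y (bg9Y (Matrix (Fin N) (Fin N) ℂ) (specialUnitaryUnits (Fin N))) (fun x => (ops x).P349) :=
    stmt349Printed_of_thm31_thm32 (geo := geo9Y) (bg := bg9Y (Matrix (Fin N) (Fin N) ℂ) (specialUnitaryUnits (Fin N))) (θ.d₆ + 1) h31 h32
      (Q := fun _ lam => lam.isRight = true) (fun x => modelSignsOn_geo9K x.toKIdx) D349 hL1 (fun _ => rfl) hR₀ hgap h261row hdict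
  exact b9_main_of_up_view₁₁B10YZW_of_obligations_W38T314SectBnHgEHsupplied θ hθ Mstar ops ζ lamW w hup hGp_e hGp_h1 hC hGA_e hGA_h1 hGA_e4 hGA_h2 hGA_l2 hGp hGA
    hA hEp hLp hGlp hH1p hE4p hH2p hK hEa hLa hGla hH1a hE4a hH2a 𝔬 rd R H κ d α ρ Nc N' Cℓ K θ₀ B₀ δ₀ a₁ M₁ ML hα hα2 hN hN' hCℓ hK0 hθ₀ hB₀ hδ₀ ha₁ hM₁ hst hκ
    hrd hloc h261 h36 hE38 evY hco0 hco1 hco2 hco3 hB₁ hδ₁ hCB hδ₁le hrest h310 r hgeo hplain t39 t310 hksum t311 t312 t313 t315 s349 s3132 t314loc P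

end Pointed

end Summit.QuantumFields.YangMills.BalabanUVNodes.N06AtRecord11ObligationsS349

end
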